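import Literature.Analysis.FluidPDE.MildL3Restart
import Literature.Analysis.FluidPDE.LerayHopfProofs
import HarnessLib

/-!
# Transitivity of the two-time duality identity (discharge of `IsMildNSSolutionBetween.trans`)

Analysis/FluidPDE support file (theorems only, no new definitions, no named facts): the
**discharge** `Literature.Analysis.FluidPDE.IsMildNSSolutionBetween.trans_holds` of the named fact
`Literature.Analysis.FluidPDE.IsMildNSSolutionBetween.trans` (`MildSolution.lean`; Fabes–Jones–
Rivière 1972, proof of Thm. 2.1; Lemarié-Rieusset 2016, Thm. 6.1 / Prop. 6.5: the Duhamel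
(very weak, Oseen) formula restarts at every time): if the forced two-time identity holds between
`s` and `τ` and between `τ` and `t`, `s ≤ τ ≤ t`, in the class `u ∈ L^∞((s,t); L^q)`, `q ≥ 2`,
`u` jointly measurable on `(s,t) × E`, `u s, u τ ∈ L^q`, `f ∈ L¹((s,t) × E)`, `0 < ν`, then it
holds between `s` and `t`.

## The proof (as printed, with one substitution)

Test the identity between `τ` and `t` with `φ` and the identity between `s` and `τ` with the
caloric field `ψ = e^{ν(t-τ)Δ}φ`; by the semigroup law `e^{νσΔ}ψ = e^{ν(t-τ+σ)Δ}φ` the datum terms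
match and the time integrals add up (`∫ₛ^τ + ∫_τ^t = ∫ₛᵗ`). The field `ψ` is smooth, divergence
free and rapidly decaying but *not* compactly supported, so the identity between `s` and `τ` must
be extended to it. The printed proofs do this by density; the tree's `MildL3Restart` (the `L³`,
unforced, three-dimensional twin) uses solenoidal truncations, which exist only in dimension
three, and `MildL3RestartAveraging` (same `L³` class, from time `0`) averages translated tests
against the heat kernel. Here, in the forced two-time class `L^∞_t L^q_x`, `q ≥ 2`, of the fact, on
an arbitrary finite-dimensional inner product space, we use the same **superposition of
translates**: `ψ(x) = ∫ K(y) φ(x - y) dy` with the Gauss–Weierstrass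
kernel `K = heatKernel (ν(t-τ))` (`heatExtension_apply`), every translate `φ(· - y)` is an
admissible test, the identity is affine in the test, and all terms are absolutely convergent
(Hölder in `x` with `u ∈ L^∞_t L^q_x`, `φ`-side in the dual exponents, `K ∈ L¹`), so integrating
the identity for `φ(· - y)` against `K(y) dy` and exchanging the integrals (Fubini) gives the
identity for `ψ`; the derivative of the caloric test commutes with the superposition
(`fderiv_heatExtension_apply_eq_heatExtension_fderiv`).

## References

* E. B. Fabes, B. F. Jones, N. M. Rivière, *The initial value problem for the Navier–Stokes
  equations with data in `L^p`*, Arch. Rational Mech. Anal. 45 (1972) 222–240, Thm. 2.1 (proof).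
  [FabesJonesRiviere1972]
* P. G. Lemarié-Rieusset, *The Navier–Stokes Problem in the 21st Century*, CRC Press 2016,
  Thm. 6.1 and Prop. 6.5 (PDF pp. 134–136), §6.2. [LemarieRieusset2016]
* T. Kato, *Strong `L^p` solutions of the Navier–Stokes equation in `ℝᵐ`*, Math. Z. 187 (1984)
  471–480, (1.7). [Kato1984]
-/

noncomputable section

open MeasureTheory TopologicalSpace Set Function Filter Topology InnerProductSpace Metric
open scoped RealInnerProductSpace ENNReal NNReal Convolution

namespace Literature.Analysis.FluidPDE

variable {E : Type*} [NormedAddCommGroup E] [InnerProductSpace ℝ E] [FiniteDimensional ℝ E]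
  [MeasurableSpace E] [BorelSpace E]

/-! ### Superposition of translates: pairings against `e^{aΔ} g` -/

open UnboundedOperators

section Superposition

/-- A translate of an `L^p` function is in `L^p` with the same norm (translation invariance of
Lebesgue measure). [folklore] -/
private theorem memLp_comp_sub_right {F : Type*} [NormedAddCommGroup F] {g : E → F} {p : ℝ≥0∞}
    (hg : MemLp g p volume) (y : E) : MemLp (fun x => g (x - y)) p volume :=
  hg.comp_measurePreserving (measurePreserving_sub_right volume y)

/-- The `L^p` norm of a translate (translation invariance of Lebesgue measure). [folklore] -/
private theorem eLpNorm_comp_sub_right {F : Type*} [NormedAddCommGroup F] {g : E → F} {p : ℝ≥0∞}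
    (hg : AEStronglyMeasurable g volume) (y : E) :
    eLpNorm (fun x => g (x - y)) p volume = eLpNorm g p volume :=
  eLpNorm_comp_measurePreserving hg (measurePreserving_sub_right volume y)

/-- **Hölder bound of a pairing**: `∫ |⟪w, h⟫| ≤ ‖w‖_q ‖h‖_{q'}` for conjugate exponents
(`1 ≤ q ≤ ∞`). [folklore] -/
private theorem integral_abs_inner_le_of_memLp_conj {w h : E → E} {q q' : ℝ≥0∞} [hqq' : q.HolderConjugate q']
    (hw : MemLp w q volume) (hh : MemLp h q' volume) :
    ∫ x, |⟪w x, h x⟫| ≤ (eLpNorm w q volume * eLpNorm h q' volume).toReal := by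
  have hint : Integrable (fun x => ⟪w x, h x⟫) volume := integrable_inner_of_memLp_conj hw hh
  have h1 : eLpNorm (fun x => ⟪w x, h x⟫) 1 volume ≤ eLpNorm w q volume * eLpNorm h q' volume := by
    have h := eLpNorm_le_eLpNorm_mul_eLpNorm_of_nnnorm hw.1 hh.1 (fun a b => ⟪a, b⟫) 1
      (Eventually.of_forall fun x => by
        simpa only [one_mul] using nnnorm_inner_le_nnnorm (𝕜 := ℝ) (w x) (h x)) (hpqr := hqq')
    simpa only [ENNReal.coe_one, one_mul] using h
  have h2 : ∫ x, |⟪w x, h x⟫| = (eLpNorm (fun x => ⟪w x, h x⟫) 1 volume).toReal := by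
    rw [eLpNorm_one_eq_lintegral_enorm, ← integral_norm_eq_lintegral_enorm hint.1]
    rfl
  rw [h2]
  exact ENNReal.toReal_mono (ENNReal.mul_ne_top hw.2.ne hh.2.ne) h1

/-- **Integrability on `E × E` of the superposition integrand**
`(y, x) ↦ K_a(y) ⟪w(x), g(x - y)⟫` for `w ∈ L^q`, `g ∈ L^{q'} ∩ C_b`, `K_a` the Gauss–Weierstrass
kernel (`‖K_a‖₁ = 1`; Hölder in `x`, uniformly in `y`; Evans, *PDE*, §2.3.1 (12) for the kernel
representation). [cite: Evans2010, §2.3.1 (12)] -/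
theorem integrable_heatKernel_mul_inner_translate {w g : E → E} {q q' : ℝ≥0∞}
    [hqq' : q.HolderConjugate q'] (hw : MemLp w q volume) (hg : Continuous g)
    (hgq : MemLp g q' volume) {a : ℝ} (ha : 0 < a) :
    Integrable (fun z : E × E => heatKernel a z.1 * ⟪w z.2, g (z.2 - z.1)⟫) (volume.prod volume) := by
  have hK : Integrable (heatKernel (E := E) a) volume := integrable_heatKernel_holds ha
  -- joint measurability
  have hmeas : AEStronglyMeasurable (fun z : E × E => heatKernel a z.1 * ⟪w z.2, g (z.2 - z.1)⟫)
      (volume.prod volume) := by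
    refine ((continuous_heatKernel a).aestronglyMeasurable.comp_fst).mul ?_
    refine (hw.1.comp_snd).inner ?_
    exact (hg.comp (continuous_snd.sub continuous_fst)).aestronglyMeasurable
  rw [integrable_prod_iff hmeas]
  refine ⟨Eventually.of_forall fun y => ?_, ?_⟩
  · -- each section `x ↦ K(y) ⟪w x, g (x - y)⟫` is integrable (Hölder)
    have h := (integrable_inner_of_memLp_conj hw (memLp_comp_sub_right hgq y)).const_mul
      (heatKernel a y)
    exact h
  · -- `y ↦ ∫ |K(y) ⟪w x, g(x - y)⟫| dx ≤ |K(y)| ‖w‖_q ‖g‖_{q'}`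
    set B : ℝ := (eLpNorm w q volume * eLpNorm g q' volume).toReal with hB
    refine Integrable.mono' (hK.norm.mul_const B) hmeas.norm.integral_prod_right' ?_
    refine Eventually.of_forall fun y => ?_
    have hgy : MemLp (fun x => g (x - y)) q' volume := memLp_comp_sub_right hgq y
    have h1 : ∫ x, ‖heatKernel a y * ⟪w x, g (x - y)⟫‖ = ‖heatKernel a y‖ * ∫ x, |⟪w x, g (x - y)⟫| := by
      rw [← integral_const_mul]
      refine integral_congr_ae (Eventually.of_forall fun x => ?_)
      simp only [norm_mul, Real.norm_eq_abs]
    rw [Real.norm_eq_abs, abs_of_nonneg (integral_nonneg fun x => norm_nonneg _), h1]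
    refine mul_le_mul_of_nonneg_left ?_ (norm_nonneg _)
    have h2 := integral_abs_inner_le_of_memLp_conj hw hgy
    rwa [eLpNorm_comp_sub_right hgq.1 y] at h2

/-- **Superposition of translates of a pairing.** For `w ∈ L^q`, `g ∈ L^{q'}` continuous and
bounded, and `a > 0`:
`∫ K_a(y) (∫ ⟪w(x), g(x - y)⟫ dx) dy = ∫ ⟪w(x), (e^{aΔ} g)(x)⟫ dx`
(`e^{aΔ} g (x) = ∫ K_a(y) g(x - y) dy`, Evans, *PDE*, §2.3.1 (12); Fubini). [cite: Evans2010, §2.3.1 (12)] -/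
theorem integral_heatKernel_mul_integral_inner_translate {w g : E → E} {q q' : ℝ≥0∞}
    [hqq' : q.HolderConjugate q'] (hw : MemLp w q volume) (hg : Continuous g)
    (hgq : MemLp g q' volume) {C : ℝ} (hgC : ∀ x, ‖g x‖ ≤ C) {a : ℝ} (ha : 0 < a) :
    ∫ y, heatKernel a y * ∫ x, ⟪w x, g (x - y)⟫ = ∫ x, ⟪w x, heatExtension g a x⟫ := by
  have hK : Integrable (heatKernel (E := E) a) volume := integrable_heatKernel_holds ha
  have hF := integrable_heatKernel_mul_inner_translate hw hg hgq ha
  -- `∫_y K ∫_x = ∫_y ∫_x K ⟪⟫ = ∫_x ∫_y K ⟪⟫`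
  have h1 : ∫ y, heatKernel a y * ∫ x, ⟪w x, g (x - y)⟫ =
      ∫ y, ∫ x, heatKernel a y * ⟪w x, g (x - y)⟫ := by
    refine integral_congr_ae (Eventually.of_forall fun y => ?_)
    exact (integral_const_mul _ _).symm
  rw [h1, integral_integral_swap hF]
  refine integral_congr_ae (Eventually.of_forall fun x => ?_)
  dsimp only
  -- `∫_y K(y) ⟪w x, g(x-y)⟫ = ⟪w x, ∫_y K(y) g(x - y)⟫ = ⟪w x, e^{aΔ} g (x)⟫`
  have hgx : MemLp (fun y => g (x - y)) ∞ volume :=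
    memLp_top_of_bound (hg.comp (continuous_const.sub continuous_id)).aestronglyMeasurable C
      (Eventually.of_forall fun y => hgC _)
  have hint : Integrable (fun y => heatKernel a y • g (x - y)) volume := hK.smul_of_top_left hgx
  rw [heatExtension_apply, ← integral_inner hint]
  refine integral_congr_ae (Eventually.of_forall fun y => ?_)
  simp only [real_inner_smul_right]

/-! ### Superposition of translates: the trilinear (transport) pairing -/

/-- `1/q + 1/q = 1/(q/2)` in `ℝ≥0∞`: the Hölder triple behind `‖|a| |b|‖_{q/2} ≤ ‖a‖_q ‖b‖_q`.
[folklore] -/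
private theorem holderTriple_self_half (q : ℝ≥0∞) : ENNReal.HolderTriple q q (q / 2) :=
  ⟨by rw [ENNReal.inv_div (Or.inl (by norm_num)) (Or.inl (by norm_num)), div_eq_mul_inv, two_mul]⟩

/-- **Trilinear Hölder bound of the transport pairing** with exponents `(q, p, q)`,
`2/q + 1/p = 1` (`q ≥ 2`; `p = ∞` when `q = 2`, `p = 1` when `q = ∞`): for `a, b ∈ L^q(E; E)` and
an operator field `Ψ ∈ L^p(E; E →L E)` the integrand `⟪a(x), Ψ(x) b(x)⟫` is integrable and
`∫ |⟪a, Ψ b⟫| ≤ ‖a‖_q ‖b‖_q ‖Ψ‖_p`. [folklore] -/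
private theorem integral_abs_inner_clm_apply_le {a b : E → E} {Ψ : E → E →L[ℝ] E} {q p : ℝ≥0∞}
    [hp : (q / 2).HolderConjugate p] (ha : MemLp a q volume) (hb : MemLp b q volume)
    (hΨ : MemLp Ψ p volume) :
    Integrable (fun x => ⟪a x, Ψ x (b x)⟫) volume ∧
      ∫ x, |⟪a x, Ψ x (b x)⟫| ≤
        (eLpNorm a q volume * eLpNorm b q volume * eLpNorm Ψ p volume).toReal := by
  haveI := holderTriple_self_half q
  -- `m = |a| |b| ∈ L^{q/2}` and `‖Ψ‖ m ∈ L¹`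
  have hm : MemLp (fun x => ‖a x‖ * ‖b x‖) (q / 2) volume := hb.norm.mul' ha.norm
  have hm_le : eLpNorm (fun x => ‖a x‖ * ‖b x‖) (q / 2) volume ≤ eLpNorm a q volume * eLpNorm b q volume := by
    have h := eLpNorm_le_eLpNorm_mul_eLpNorm_of_nnnorm ha.1.norm hb.1.norm (fun s t : ℝ => s * t) 1
      (Eventually.of_forall fun x => by simp) (hpqr := holderTriple_self_half q)
    simpa only [ENNReal.coe_one, one_mul, eLpNorm_norm] using h
  have hprod : MemLp (fun x => ‖Ψ x‖ * (‖a x‖ * ‖b x‖)) 1 volume := hm.mul' hΨ.norm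
  have hprod_le : eLpNorm (fun x => ‖Ψ x‖ * (‖a x‖ * ‖b x‖)) 1 volume ≤
      eLpNorm Ψ p volume * (eLpNorm a q volume * eLpNorm b q volume) := by
    have h := eLpNorm_le_eLpNorm_mul_eLpNorm_of_nnnorm hΨ.1.norm hm.1 (fun s t : ℝ => s * t) 1
      (Eventually.of_forall fun x => by simp) (hpqr := hp.symm)
    simp only [ENNReal.coe_one, one_mul, eLpNorm_norm] at h
    exact h.trans (by gcongr)
  have hint1 : Integrable (fun x => ‖Ψ x‖ * (‖a x‖ * ‖b x‖)) volume :=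
    memLp_one_iff_integrable.1 hprod
  -- measurability and pointwise domination of the pairing
  have hmeas : AEStronglyMeasurable (fun x => ⟪a x, Ψ x (b x)⟫) volume := by
    refine ha.1.inner ?_
    exact (isBoundedBilinearMap_apply (𝕜 := ℝ) (E := E) (F := E)).continuous
      |>.comp_aestronglyMeasurable (hΨ.1.prodMk hb.1)
  have hpt : ∀ x, ‖⟪a x, Ψ x (b x)⟫‖ ≤ ‖Ψ x‖ * (‖a x‖ * ‖b x‖) := fun x => by
    calc ‖⟪a x, Ψ x (b x)⟫‖ ≤ ‖a x‖ * ‖Ψ x (b x)‖ := norm_inner_le_norm _ _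
      _ ≤ ‖a x‖ * (‖Ψ x‖ * ‖b x‖) :=
          mul_le_mul_of_nonneg_left (ContinuousLinearMap.le_opNorm _ _) (norm_nonneg _)
      _ = ‖Ψ x‖ * (‖a x‖ * ‖b x‖) := by ring
  have hint : Integrable (fun x => ⟪a x, Ψ x (b x)⟫) volume :=
    hint1.mono' hmeas (Eventually.of_forall hpt)
  refine ⟨hint, ?_⟩
  have hfin : eLpNorm Ψ p volume * (eLpNorm a q volume * eLpNorm b q volume) ≠ ⊤ :=
    ENNReal.mul_ne_top hΨ.2.ne (ENNReal.mul_ne_top ha.2.ne hb.2.ne)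
  calc ∫ x, |⟪a x, Ψ x (b x)⟫| ≤ ∫ x, ‖Ψ x‖ * (‖a x‖ * ‖b x‖) :=
        integral_mono hint.norm hint1 fun x => hpt x
    _ = (eLpNorm (fun x => ‖Ψ x‖ * (‖a x‖ * ‖b x‖)) 1 volume).toReal := by
        rw [eLpNorm_one_eq_lintegral_enorm, ← integral_norm_eq_lintegral_enorm hint1.1]
        refine integral_congr_ae (Eventually.of_forall fun x => ?_)
        simp only [norm_mul, norm_norm]
    _ ≤ (eLpNorm Ψ p volume * (eLpNorm a q volume * eLpNorm b q volume)).toReal :=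
        ENNReal.toReal_mono hfin hprod_le
    _ = (eLpNorm a q volume * eLpNorm b q volume * eLpNorm Ψ p volume).toReal := by
        rw [mul_comm]

/-- **Integrability on `E × E` of the trilinear superposition integrand**
`(y, x) ↦ K_a(y) ⟪a(x), Ψ(x - y) b(x)⟫` (`a, b ∈ L^q`, `Ψ ∈ L^p` continuous, `2/q + 1/p = 1`;
kernel representation of Evans, *PDE*, §2.3.1 (12)). [cite: Evans2010, §2.3.1 (12)] -/
theorem integrable_heatKernel_mul_inner_clm_translate {a b : E → E} {Ψ : E → E →L[ℝ] E}
    {q p : ℝ≥0∞} [hp : (q / 2).HolderConjugate p] (ha : MemLp a q volume) (hb : MemLp b q volume)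
    (hΨ : Continuous Ψ) (hΨp : MemLp Ψ p volume) {r : ℝ} (hr : 0 < r) :
    Integrable (fun z : E × E => heatKernel r z.1 * ⟪a z.2, Ψ (z.2 - z.1) (b z.2)⟫)
      (volume.prod volume) := by
  have hK : Integrable (heatKernel (E := E) r) volume := integrable_heatKernel_holds hr
  have hmeas : AEStronglyMeasurable
      (fun z : E × E => heatKernel r z.1 * ⟪a z.2, Ψ (z.2 - z.1) (b z.2)⟫) (volume.prod volume) := by
    refine ((continuous_heatKernel r).aestronglyMeasurable.comp_fst).mul ?_
    refine (ha.1.comp_snd).inner ?_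
    exact (isBoundedBilinearMap_apply (𝕜 := ℝ) (E := E) (F := E)).continuous
      |>.comp_aestronglyMeasurable
        (((hΨ.comp (continuous_snd.sub continuous_fst)).aestronglyMeasurable).prodMk hb.1.comp_snd)
  rw [integrable_prod_iff hmeas]
  refine ⟨Eventually.of_forall fun y => ?_, ?_⟩
  · have h := (integral_abs_inner_clm_apply_le ha hb (memLp_comp_sub_right hΨp y)).1.const_mul
      (heatKernel r y)
    exact h
  · set B : ℝ := (eLpNorm a q volume * eLpNorm b q volume * eLpNorm Ψ p volume).toReal with hB
    refine Integrable.mono' (hK.norm.mul_const B) hmeas.norm.integral_prod_right' ?_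
    refine Eventually.of_forall fun y => ?_
    have hΨy : MemLp (fun x => Ψ (x - y)) p volume := memLp_comp_sub_right hΨp y
    have h1 : ∫ x, ‖heatKernel r y * ⟪a x, Ψ (x - y) (b x)⟫‖ =
        ‖heatKernel r y‖ * ∫ x, |⟪a x, Ψ (x - y) (b x)⟫| := by
      rw [← integral_const_mul]
      refine integral_congr_ae (Eventually.of_forall fun x => ?_)
      simp only [norm_mul, Real.norm_eq_abs]
    rw [Real.norm_eq_abs, abs_of_nonneg (integral_nonneg fun x => norm_nonneg _), h1]
    refine mul_le_mul_of_nonneg_left ?_ (norm_nonneg _)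
    have h2 := (integral_abs_inner_clm_apply_le ha hb hΨy).2
    rwa [eLpNorm_comp_sub_right hΨp.1 y] at h2

/-- **Superposition of translates of the transport pairing.** For `a, b ∈ L^q`, a continuous
bounded operator field `Ψ ∈ L^p` (`2/q + 1/p = 1`) and `r > 0`:
`∫ K_r(y) (∫ ⟪a(x), Ψ(x - y) b(x)⟫ dx) dy = ∫ ⟪a(x), (e^{rΔ} Ψ)(x) b(x)⟫ dx`
(Evans, *PDE*, §2.3.1 (12); Fubini). [cite: Evans2010, §2.3.1 (12)] -/
theorem integral_heatKernel_mul_integral_inner_clm_translate {a b : E → E} {Ψ : E → E →L[ℝ] E}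
    {q p : ℝ≥0∞} [hp : (q / 2).HolderConjugate p] (ha : MemLp a q volume) (hb : MemLp b q volume)
    (hΨ : Continuous Ψ) (hΨp : MemLp Ψ p volume) {C : ℝ} (hΨC : ∀ x, ‖Ψ x‖ ≤ C)
    {r : ℝ} (hr : 0 < r) :
    ∫ y, heatKernel r y * ∫ x, ⟪a x, Ψ (x - y) (b x)⟫ =
      ∫ x, ⟪a x, heatExtension Ψ r x (b x)⟫ := by
  have hK : Integrable (heatKernel (E := E) r) volume := integrable_heatKernel_holds hr
  have hF := integrable_heatKernel_mul_inner_clm_translate ha hb hΨ hΨp hr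
  have h1 : ∫ y, heatKernel r y * ∫ x, ⟪a x, Ψ (x - y) (b x)⟫ =
      ∫ y, ∫ x, heatKernel r y * ⟪a x, Ψ (x - y) (b x)⟫ := by
    refine integral_congr_ae (Eventually.of_forall fun y => ?_)
    exact (integral_const_mul _ _).symm
  rw [h1, integral_integral_swap hF]
  refine integral_congr_ae (Eventually.of_forall fun x => ?_)
  dsimp only
  have hΨx : MemLp (fun y => Ψ (x - y)) ∞ volume :=
    memLp_top_of_bound (hΨ.comp (continuous_const.sub continuous_id)).aestronglyMeasurable C
      (Eventually.of_forall fun y => hΨC _)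
  have hint : Integrable (fun y => heatKernel r y • Ψ (x - y)) volume := hK.smul_of_top_left hΨx
  have hint' : Integrable (fun y => (heatKernel r y • Ψ (x - y)) (b x)) volume :=
    (ContinuousLinearMap.apply ℝ E (b x)).integrable_comp hint
  rw [heatExtension_apply, ContinuousLinearMap.integral_apply hint, ← integral_inner hint']
  refine integral_congr_ae (Eventually.of_forall fun y => ?_)
  show heatKernel r y * ⟪a x, Ψ (x - y) (b x)⟫ = ⟪a x, (heatKernel r y • Ψ (x - y)) (b x)⟫
  rw [_root_.smul_apply, real_inner_smul_right]

end Superposition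

/-! ### The caloric test of a test field: toolkit -/

section Toolkit

variable {ν : ℝ} {φ : E → E}

/-- Translates of the caloric test field: `e^{νaΔ}(φ(· - y)) = (e^{νaΔ}φ)(· - y)` (the heat
kernel is a convolution kernel, Evans, *PDE*, §2.3.1; both sides are the same integral, so this
holds for every `a`, and trivially for `νa ≤ 0` where the flow is the identity; same statement as
`KatoSymmetryCovariance`'s `heatTest_comp_add_right`, re-proved here to keep this file's import
cone small). [folklore] -/
private theorem heatTest_comp_sub_right (ν : ℝ) (φ : E → E) (y : E) (a : ℝ) (x : E) :
    heatTest ν (fun x => φ (x - y)) a x = heatTest ν φ a (x - y) := by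
  unfold heatTest
  rcases le_or_gt (ν * a) 0 with h | h
  · rw [heatFlow_of_nonpos _ h, heatFlow_of_nonpos _ h]
  · rw [heatFlow_of_pos _ h, heatFlow_of_pos _ h, UnboundedOperators.heatExtension_apply,
      UnboundedOperators.heatExtension_apply]
    congr 1
    funext z
    rw [sub_right_comm x z y]

omit [FiniteDimensional ℝ E] [MeasurableSpace E] [BorelSpace E] in
/-- A translate of a test field is a test field (Evans, *PDE*, §5.2.1). [folklore] -/
private theorem isTestFunctionOn_comp_sub_right_top
    (hφ : FunctionSpaces.IsTestFunctionOn (⊤ : Opens E) φ) (y : E) :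
    FunctionSpaces.IsTestFunctionOn (⊤ : Opens E) (fun x => φ (x - y)) where
  contDiff := hφ.contDiff.comp (contDiff_id.sub contDiff_const)
  hasCompactSupport := hφ.hasCompactSupport.comp_homeomorph (Homeomorph.subRight y)
  tsupport_subset := by simp

omit [FiniteDimensional ℝ E] [MeasurableSpace E] [BorelSpace E] in
/-- A translate of a divergence-free field is divergence free (`D(φ(· - y))(x) = Dφ(x - y)`,
Mathlib `fderiv_comp_add_right`). [folklore] -/
private theorem isDivFree_comp_sub_right {φ : E → E} (h : VectorCalculus.IsDivFree φ)
    (y : E) : VectorCalculus.IsDivFree (fun x => φ (x - y)) := by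
  intro x
  have hx := h (x + -y)
  simp only [VectorCalculus.divergence] at hx ⊢
  simp only [sub_eq_add_neg]
  rw [fderiv_comp_add_right]
  exact hx

/-- Sup bound of the caloric test field, every elapsed time (maximum principle). [folklore] -/
private theorem norm_heatTest_le_of_bound {C : ℝ} (hC : ∀ z, ‖φ z‖ ≤ C) (a : ℝ) (x : E) :
    ‖heatTest ν φ a x‖ ≤ C :=
  norm_heatFlow_le hC _ _

/-- The caloric test of `C^n_c` data is `C^n`. [folklore] -/
private theorem contDiff_heatTest_of_hasCompactSupport {n : ℕ∞} (hφ : ContDiff ℝ n φ) (hc : HasCompactSupport φ) (a : ℝ) :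
    ContDiff ℝ n (heatTest ν φ a) :=
  contDiff_heatFlow hφ hc _

/-- The caloric test of `L^p` data is in `L^p` (`1 ≤ p`, `ν, a ≥ 0`). [folklore] -/
private theorem memLp_heatTest_of_memLp (hν : 0 ≤ ν) {p : ℝ≥0∞} (hφ : MemLp φ p volume) (hp : 1 ≤ p) {a : ℝ}
    (ha : 0 ≤ a) : MemLp (heatTest ν φ a) p volume :=
  memLp_heatFlow_holds hφ hp (mul_nonneg hν ha)

/-- Sup bound of the gradient of the caloric test field: `‖D(e^{νaΔ}φ)‖_∞ ≤ ‖Dφ‖_∞`, `a ≥ 0`.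
[folklore] -/
private theorem norm_fderiv_heatTest_le (hν : 0 < ν) (hφ : ContDiff ℝ 1 φ) (hc : HasCompactSupport φ)
    {C : ℝ} (hC : ∀ z, ‖fderiv ℝ φ z‖ ≤ C) {a : ℝ} (ha : 0 ≤ a) (x : E) :
    ‖fderiv ℝ (heatTest ν φ a) x‖ ≤ C := by
  rcases ha.eq_or_lt with h | h
  · rw [← h, heatTest_zero_right]
    exact hC x
  · rw [fderiv_heatTest_of_pos hν h hφ hc]
    exact UnboundedOperators.norm_heatExtension_le hC (mul_pos hν h) x

/-- **Semigroup law for the caloric test field**: `e^{νσΔ}(e^{νaΔ}φ) = e^{ν(a+σ)Δ}φ` for `a ≥ 0`,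
`σ > 0` (`φ ∈ L²`; Fabes–Jones–Rivière 1972, §2, the caloric test fields form a semigroup in the
elapsed time). [cite: FabesJonesRiviere1972, §2] -/
theorem heatExtension_heatTest_eq_heatTest_add (hν : 0 < ν) (hφ2 : MemLp φ 2 volume) {a : ℝ} (ha : 0 ≤ a)
    {σ : ℝ} (hσ : 0 < σ) :
    UnboundedOperators.heatExtension (heatTest ν φ a) (ν * σ) = heatTest ν φ (a + σ) := by
  have h1 : heatTest ν φ (a + σ) = heatFlow (heatFlow φ (ν * a)) (ν * σ) := by
    change heatFlow φ (ν * (a + σ)) = _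
    rw [heatFlow_heatFlow_holds hφ2 (by norm_num) (mul_nonneg hν.le ha) (mul_nonneg hν.le hσ.le)]
    congr 1
    ring
  rw [h1, heatFlow_of_pos _ (mul_pos hν hσ)]
  rfl

/-- **The superposition of the gradient of the caloric test is the gradient of a later caloric
test**: `e^{νσΔ}(D e^{νaΔ}φ)(x) = D(e^{ν(a+σ)Δ}φ)(x)` for a `C¹_c` test field, `a ≥ 0`, `σ > 0`
(derivatives fall on the data, Lemarié-Rieusset 2016, §6.2, `W_{νt} ∗ ∂^α u₀ = ∂^α (W_{νt} ∗ u₀)`;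
semigroup law). [cite: LemarieRieusset2016, §6.2] -/
theorem heatExtension_fderiv_heatTest_eq_fderiv_heatTest_add (hν : 0 < ν) (hφ : ContDiff ℝ 1 φ)
    (hc : HasCompactSupport φ) {a : ℝ} (ha : 0 ≤ a) {σ : ℝ} (hσ : 0 < σ) (x : E) :
    UnboundedOperators.heatExtension (fderiv ℝ (heatTest ν φ a)) (ν * σ) x =
      fderiv ℝ (heatTest ν φ (a + σ)) x := by
  have hD : MemLp (fderiv ℝ φ) 1 volume :=
    (hφ.continuous_fderiv one_ne_zero).memLp_of_hasCompactSupport (hc.fderiv ℝ)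
  rcases ha.eq_or_lt with h | h
  · subst h
    rw [heatTest_zero_right, zero_add, fderiv_heatTest_of_pos hν hσ hφ hc]
  · have heq : fderiv ℝ (heatTest ν φ a) = UnboundedOperators.heatExtension (fderiv ℝ φ) (ν * a) :=
      funext fun x => fderiv_heatTest_of_pos hν h hφ hc x
    rw [heq, UnboundedOperators.heatExtension_add_holds hD le_rfl (mul_pos hν h) (mul_pos hν hσ),
      fderiv_heatTest_of_pos hν (by linarith) hφ hc]
    congr 1
    ring

end Toolkit

/-! ### The nonlinear term: measurability, bounds, superposition on a time slab -/

section Nonlinear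

variable {ν : ℝ} {φ : E → E} {u : ℝ → E → E} {s τ : ℝ} {q p : ℝ≥0∞}

/-- The product measure `dy ⊗ (dr on (s,τ)) ⊗ dx` gives full measure to `{r ∈ (s, τ)}`. [folklore] -/
private theorem ae_snd_fst_mem_Ioo (s τ : ℝ) :
    ∀ᵐ z : (E × ℝ) × E ∂(((volume : Measure E).prod (volume.restrict (Ioo s τ))).prod
      (volume : Measure E)), z.1.2 ∈ Ioo s τ := by
  have h1 : ∀ᵐ r : ℝ ∂(volume.restrict (Ioo s τ)), r ∈ Ioo s τ := ae_restrict_mem measurableSet_Ioo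
  have hq : Measure.QuasiMeasurePreserving (fun z : (E × ℝ) × E => z.1.2)
      (((volume : Measure E).prod (volume.restrict (Ioo s τ))).prod (volume : Measure E))
      (volume.restrict (Ioo s τ)) :=
    Measure.quasiMeasurePreserving_snd.comp Measure.quasiMeasurePreserving_fst
  exact hq.ae h1

/-- A jointly measurable field on the slab `(s,τ) × E`, viewed on `E_y × (s,τ)_r × E_x` through
`(r, x)`. [folklore] -/
private theorem aestronglyMeasurable_slab_lift
    (hmeas : AEStronglyMeasurable (uncurry u) ((volume.restrict (Ioo s τ)).prod (volume : Measure E))) :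
    AEStronglyMeasurable (fun z : (E × ℝ) × E => u z.1.2 z.2)
      (((volume : Measure E).prod (volume.restrict (Ioo s τ))).prod (volume : Measure E)) := by
  have hq : Measure.QuasiMeasurePreserving
      (Prod.snd ∘ (MeasurableEquiv.prodAssoc : (E × ℝ) × E ≃ᵐ E × ℝ × E))
      (((volume : Measure E).prod (volume.restrict (Ioo s τ))).prod (volume : Measure E))
      ((volume.restrict (Ioo s τ)).prod (volume : Measure E)) :=
    Measure.quasiMeasurePreserving_snd.comp
      (measurePreserving_prodAssoc (volume : Measure E) (volume.restrict (Ioo s τ))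
        (volume : Measure E)).quasiMeasurePreserving
  have h := hmeas.comp_quasiMeasurePreserving hq
  exact h

/-- **Joint measurability of the translated transport integrand**
`((y, r), x) ↦ ⟪u(r,x), D(e^{ν(τ-r)Δ}φ)(x - y) u(r,x)⟫` on `E × (s,τ) × E`. [folklore] -/
private theorem aestronglyMeasurable_transport_translate (hν : 0 < ν) (hφ : ContDiff ℝ 1 φ)
    (hc : HasCompactSupport φ)
    (hmeas : AEStronglyMeasurable (uncurry u) ((volume.restrict (Ioo s τ)).prod (volume : Measure E))) :
    AEStronglyMeasurable (fun z : (E × ℝ) × E =>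
        ⟪u z.1.2 z.2, fderiv ℝ (heatTest ν φ (τ - z.1.2)) (z.2 - z.1.1) (u z.1.2 z.2)⟫)
      (((volume : Measure E).prod (volume.restrict (Ioo s τ))).prod (volume : Measure E)) := by
  set μ := ((volume : Measure E).prod (volume.restrict (Ioo s τ))).prod (volume : Measure E) with hμ
  have hU := aestronglyMeasurable_slab_lift hmeas
  -- the operator field is continuous on `{r < τ}`, a set of full measure
  set S : Set ((E × ℝ) × E) := {z | z.1.2 ∈ Ioo s τ} with hS
  have hSm : MeasurableSet S :=
    measurableSet_Ioo.preimage (measurable_snd.comp measurable_fst)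
  have hΨc : ContinuousOn (fun z : (E × ℝ) × E => fderiv ℝ (heatTest ν φ (τ - z.1.2)) (z.2 - z.1.1)) S := by
    have hc2 : Continuous fun z : (E × ℝ) × E => ((τ - z.1.2, z.2 - z.1.1) : ℝ × E) := by fun_prop
    have h := (continuousOn_fderiv_heatTest hν hφ hc).comp hc2.continuousOn
      (fun z (hz : z ∈ S) => ⟨show (0 : ℝ) < τ - z.1.2 from sub_pos.2 hz.2, mem_univ _⟩)
    simpa only [Function.comp_def] using h
  have hae : ∀ᵐ z ∂μ, z ∈ S := ae_snd_fst_mem_Ioo (E := E) s τ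
  have hΨ : AEStronglyMeasurable
      (fun z : (E × ℝ) × E => fderiv ℝ (heatTest ν φ (τ - z.1.2)) (z.2 - z.1.1)) μ := by
    have h := hΨc.aestronglyMeasurable (μ := μ) hSm
    rwa [Measure.restrict_eq_self_of_ae_mem hae] at h
  exact hU.inner ((isBoundedBilinearMap_apply (𝕜 := ℝ) (E := E) (F := E)).continuous
    |>.comp_aestronglyMeasurable (hΨ.prodMk hU))

/-- **Uniform bound of the translated transport pairing**: if `‖u(r)‖_q ≤ M` then for every `y`,
`|∫ ⟪u(r,x), D(e^{νaΔ}φ)(x - y) u(r,x)⟫ dx| ≤ M² ‖Dφ‖_p`, `2/q + 1/p = 1`, `a ≥ 0`. [folklore] -/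
private theorem abs_integral_transport_translate_le (hν : 0 < ν) (hφ : ContDiff ℝ 1 φ)
    (hc : HasCompactSupport φ) [hp : (q / 2).HolderConjugate p] (hp1 : 1 ≤ p) {r : ℝ} {M : ℝ≥0∞}
    (hMt : M ≠ ⊤) (hur : MemLp (u r) q volume) (hM : eLpNorm (u r) q volume ≤ M) {a : ℝ}
    (ha : 0 ≤ a) (y : E) :
    |∫ x, ⟪u r x, fderiv ℝ (heatTest ν φ a) (x - y) (u r x)⟫| ≤
      (M * M * eLpNorm (fderiv ℝ φ) p volume).toReal := by
  have hΨ : MemLp (fderiv ℝ (heatTest ν φ a)) p volume := memLp_fderiv_heatTest hν ha hφ hc hp1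
  have hΨy : MemLp (fun x => fderiv ℝ (heatTest ν φ a) (x - y)) p volume := memLp_comp_sub_right hΨ y
  have h := integral_abs_inner_clm_apply_le hur hur hΨy
  calc |∫ x, ⟪u r x, fderiv ℝ (heatTest ν φ a) (x - y) (u r x)⟫|
      ≤ ∫ x, |⟪u r x, fderiv ℝ (heatTest ν φ a) (x - y) (u r x)⟫| := abs_integral_le_integral_abs
    _ ≤ (eLpNorm (u r) q volume * eLpNorm (u r) q volume *
          eLpNorm (fun x => fderiv ℝ (heatTest ν φ a) (x - y)) p volume).toReal := h.2
    _ ≤ (M * M * eLpNorm (fderiv ℝ φ) p volume).toReal := by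
        refine ENNReal.toReal_mono ?_ ?_
        · exact ENNReal.mul_ne_top (ENNReal.mul_ne_top hMt hMt)
            ((hφ.continuous_fderiv one_ne_zero).memLp_of_hasCompactSupport (hc.fderiv ℝ)).2.ne
        · rw [eLpNorm_comp_sub_right hΨ.1 y]
          gcongr
          exact eLpNorm_fderiv_heatTest_le hν ha hφ hc hp1

/-- **Integrability on `E_y × (s,τ)_r` of the kernel-weighted translated transport pairing**
`(y, r) ↦ K(y) ∫ ⟪u(r,x), D(e^{ν(τ-r)Δ}φ)(x - y) u(r,x)⟫ dx`, for `u` jointly measurable with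
`‖u(r)‖_q ≤ M < ∞` for a.e. `r ∈ (s, τ)` (dominated by `|K(y)| M² ‖Dφ‖_p`). [folklore] -/
private theorem integrable_heatKernel_mul_transport_translate (hν : 0 < ν) (hφ : ContDiff ℝ 1 φ)
    (hc : HasCompactSupport φ) [hp : (q / 2).HolderConjugate p] (hp1 : 1 ≤ p)
    (hmeas : AEStronglyMeasurable (uncurry u) ((volume.restrict (Ioo s τ)).prod (volume : Measure E)))
    {M : ℝ≥0∞} (hMt : M ≠ ⊤)
    (hae : ∀ᵐ r ∂(volume.restrict (Ioo s τ)), MemLp (u r) q volume ∧ eLpNorm (u r) q volume ≤ M)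
    {b : ℝ} (hb : 0 < b) :
    Integrable (fun z : E × ℝ => heatKernel b z.1 *
        ∫ x, ⟪u z.2 x, fderiv ℝ (heatTest ν φ (τ - z.2)) (x - z.1) (u z.2 x)⟫)
      ((volume : Measure E).prod (volume.restrict (Ioo s τ))) := by
  haveI : IsFiniteMeasure (volume.restrict (Ioo s τ) : Measure ℝ) :=
    isFiniteMeasure_restrict.2 measure_Ioo_lt_top.ne
  have hK : Integrable (heatKernel (E := E) b) volume := integrable_heatKernel_holds hb
  have hH := aestronglyMeasurable_transport_translate hν hφ hc hmeas (τ := τ)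
  have hG : AEStronglyMeasurable (fun z : E × ℝ =>
      ∫ x, ⟪u z.2 x, fderiv ℝ (heatTest ν φ (τ - z.2)) (x - z.1) (u z.2 x)⟫)
      ((volume : Measure E).prod (volume.restrict (Ioo s τ))) := hH.integral_prod_right'
  have hJm : AEStronglyMeasurable (fun z : E × ℝ => heatKernel b z.1 *
      ∫ x, ⟪u z.2 x, fderiv ℝ (heatTest ν φ (τ - z.2)) (x - z.1) (u z.2 x)⟫)
      ((volume : Measure E).prod (volume.restrict (Ioo s τ))) :=
    ((continuous_heatKernel b).aestronglyMeasurable.comp_fst).mul hG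
  set B : ℝ := (M * M * eLpNorm (fderiv ℝ φ) p volume).toReal with hB
  have hdom : Integrable (fun z : E × ℝ => ‖heatKernel b z.1‖ * B)
      ((volume : Measure E).prod (volume.restrict (Ioo s τ))) :=
    hK.norm.mul_prod (integrable_const B)
  refine hdom.mono' hJm ?_
  -- the bound holds for a.e. `(y, r)`: `r` in the good set
  have hae' : ∀ᵐ z : E × ℝ ∂((volume : Measure E).prod (volume.restrict (Ioo s τ))),
      (MemLp (u z.2) q volume ∧ eLpNorm (u z.2) q volume ≤ M) ∧ z.2 ∈ Ioo s τ :=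
    (Measure.quasiMeasurePreserving_snd).ae (hae.and (ae_restrict_mem measurableSet_Ioo))
  filter_upwards [hae'] with z hz
  rw [norm_mul, Real.norm_eq_abs (∫ x, _)]
  refine mul_le_mul_of_nonneg_left ?_ (norm_nonneg _)
  exact abs_integral_transport_translate_le hν hφ hc hp1 hMt hz.1.1 hz.1.2
    (sub_nonneg.2 hz.2.2.le) z.1

/-- **Superposition of translates of the nonlinear term on a time slab.** With `K = heatKernel (νσ)`:
`∫ K(y) (∫_{(s,τ)} ∫ ⟪u(r,x), D(e^{ν(τ-r)Δ}φ)(x - y) u(r,x)⟫ dx dr) dy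
  = ∫_{(s,τ)} ∫ ⟪u(r,x), D(e^{ν(τ-r+σ)Δ}φ)(x) u(r,x)⟫ dx dr`,
and the `y`-integrand is integrable (Fubini twice; derivatives of the caloric test commute with
the superposition). [folklore] -/
private theorem integral_heatKernel_mul_setIntegral_transport (hν : 0 < ν) (hφ : ContDiff ℝ 1 φ)
    (hc : HasCompactSupport φ) [hp : (q / 2).HolderConjugate p] (hp1 : 1 ≤ p)
    (hmeas : AEStronglyMeasurable (uncurry u) ((volume.restrict (Ioo s τ)).prod (volume : Measure E)))
    {M : ℝ≥0∞} (hMt : M ≠ ⊤)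
    (hae : ∀ᵐ r ∂(volume.restrict (Ioo s τ)), MemLp (u r) q volume ∧ eLpNorm (u r) q volume ≤ M)
    {σ : ℝ} (hσ : 0 < σ) :
    Integrable (fun y => heatKernel (ν * σ) y *
        ∫ r in Ioo s τ, ∫ x, ⟪u r x, fderiv ℝ (heatTest ν φ (τ - r)) (x - y) (u r x)⟫) volume ∧
      ∫ y, heatKernel (ν * σ) y *
          ∫ r in Ioo s τ, ∫ x, ⟪u r x, fderiv ℝ (heatTest ν φ (τ - r)) (x - y) (u r x)⟫ =
        ∫ r in Ioo s τ, ∫ x, ⟪u r x, fderiv ℝ (heatTest ν φ (τ - r + σ)) x (u r x)⟫ := by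
  have hb : 0 < ν * σ := mul_pos hν hσ
  have hJ := integrable_heatKernel_mul_transport_translate hν hφ hc hp1 hmeas hMt hae hb (τ := τ)
  -- `K(y) ∫_r G = ∫_r K(y) G`
  have hrw : ∀ y : E, heatKernel (ν * σ) y *
      ∫ r in Ioo s τ, ∫ x, ⟪u r x, fderiv ℝ (heatTest ν φ (τ - r)) (x - y) (u r x)⟫ =
      ∫ r in Ioo s τ, heatKernel (ν * σ) y *
        ∫ x, ⟪u r x, fderiv ℝ (heatTest ν φ (τ - r)) (x - y) (u r x)⟫ :=
    fun y => (integral_const_mul _ _).symm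
  refine ⟨(hJ.integral_prod_left).congr (Eventually.of_forall fun y => (hrw y).symm), ?_⟩
  simp_rw [hrw]
  rw [integral_integral_swap hJ]
  -- for a.e. `r`: superposition in `y`, then derivative/semigroup
  refine integral_congr_ae ?_
  filter_upwards [hae, ae_restrict_mem measurableSet_Ioo] with r hr hrI
  have hτr : 0 ≤ τ - r := sub_nonneg.2 hrI.2.le
  obtain ⟨CD, hCD⟩ := (hφ.continuous_fderiv one_ne_zero).bounded_above_of_compact_support
    (hc.fderiv ℝ)
  have hΨc : Continuous (fderiv ℝ (heatTest ν φ (τ - r))) :=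
    (contDiff_heatTest_of_hasCompactSupport hφ hc _).continuous_fderiv one_ne_zero
  have hΨp : MemLp (fderiv ℝ (heatTest ν φ (τ - r))) p volume :=
    memLp_fderiv_heatTest hν hτr hφ hc hp1
  have hΨC : ∀ x, ‖fderiv ℝ (heatTest ν φ (τ - r)) x‖ ≤ CD :=
    norm_fderiv_heatTest_le hν hφ hc hCD hτr
  rw [integral_heatKernel_mul_integral_inner_clm_translate hr.1 hr.1 hΨc hΨp hΨC hb]
  refine integral_congr_ae (Eventually.of_forall fun x => ?_)
  dsimp only
  rw [heatExtension_fderiv_heatTest_eq_fderiv_heatTest_add hν hφ hc hτr hσ]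

end Nonlinear

/-! ### The force term: measurability, bounds, superposition on a time slab -/

section Force

variable {ν : ℝ} {φ : E → E} {f : ℝ → E → E} {s τ : ℝ}

/-- **Joint measurability of the translated force pairing**
`((y, r), x) ↦ ⟪f(r,x), (e^{ν(τ-r)Δ}φ)(x - y)⟫` on `E × (s,τ) × E`. [folklore] -/
private theorem aestronglyMeasurable_force_translate (hν : 0 < ν)
    (hφ : FunctionSpaces.IsTestFunctionOn (⊤ : Opens E) φ)
    (hf : AEStronglyMeasurable (uncurry f) ((volume.restrict (Ioo s τ)).prod (volume : Measure E))) :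
    AEStronglyMeasurable (fun z : (E × ℝ) × E =>
        ⟪f z.1.2 z.2, heatTest ν φ (τ - z.1.2) (z.2 - z.1.1)⟫)
      (((volume : Measure E).prod (volume.restrict (Ioo s τ))).prod (volume : Measure E)) := by
  set μ := ((volume : Measure E).prod (volume.restrict (Ioo s τ))).prod (volume : Measure E) with hμ
  have hF := aestronglyMeasurable_slab_lift hf
  obtain ⟨C, hC⟩ := hφ.contDiff.continuous.bounded_above_of_compact_support hφ.hasCompactSupport
  set S : Set ((E × ℝ) × E) := {z | z.1.2 ∈ Ioo s τ} with hS
  have hSm : MeasurableSet S :=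
    measurableSet_Ioo.preimage (measurable_snd.comp measurable_fst)
  have hψc : ContinuousOn (fun z : (E × ℝ) × E => heatTest ν φ (τ - z.1.2) (z.2 - z.1.1)) S := by
    have hc2 : Continuous fun z : (E × ℝ) × E => ((ν * (τ - z.1.2), z.2 - z.1.1) : ℝ × E) := by
      fun_prop
    have h := (UnboundedOperators.continuousOn_uncurry_heatExtension hφ.contDiff.continuous hC).comp
      hc2.continuousOn
      (fun z (hz : z ∈ S) => ⟨show (0 : ℝ) < ν * (τ - z.1.2) from mul_pos hν (sub_pos.2 hz.2),
        mem_univ _⟩)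
    refine ContinuousOn.congr (by simpa only [Function.comp_def] using h) fun z hz => ?_
    exact congrFun (heatTest_of_pos hν (sub_pos.2 hz.2) φ) _
  have hae : ∀ᵐ z ∂μ, z ∈ S := ae_snd_fst_mem_Ioo (E := E) s τ
  have hψ : AEStronglyMeasurable
      (fun z : (E × ℝ) × E => heatTest ν φ (τ - z.1.2) (z.2 - z.1.1)) μ := by
    have h := hψc.aestronglyMeasurable (μ := μ) hSm
    rwa [Measure.restrict_eq_self_of_ae_mem hae] at h
  exact hF.inner hψ

/-- **Superposition of translates of the force term on a time slab.** With `K = heatKernel (νσ)`: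
`∫ K(y) (∫_{(s,τ)} ∫ ⟪f(r,x), (e^{ν(τ-r)Δ}φ)(x - y)⟫ dx dr) dy
  = ∫_{(s,τ)} ∫ ⟪f(r,x), (e^{ν(τ-r+σ)Δ}φ)(x)⟫ dx dr`
for `f ∈ L¹((s,τ) × E)`, and the `y`-integrand is integrable. [folklore] -/
private theorem integral_heatKernel_mul_setIntegral_force (hν : 0 < ν)
    (hφ : FunctionSpaces.IsTestFunctionOn (⊤ : Opens E) φ)
    (hf : Integrable (uncurry f) ((volume.restrict (Ioo s τ)).prod (volume : Measure E)))
    {σ : ℝ} (hσ : 0 < σ) :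
    Integrable (fun y => heatKernel (ν * σ) y *
        ∫ r in Ioo s τ, ∫ x, ⟪f r x, heatTest ν φ (τ - r) (x - y)⟫) volume ∧
      ∫ y, heatKernel (ν * σ) y * ∫ r in Ioo s τ, ∫ x, ⟪f r x, heatTest ν φ (τ - r) (x - y)⟫ =
        ∫ r in Ioo s τ, ∫ x, ⟪f r x, heatTest ν φ (τ - r + σ) x⟫ := by
  haveI : IsFiniteMeasure (volume.restrict (Ioo s τ) : Measure ℝ) :=
    isFiniteMeasure_restrict.2 measure_Ioo_lt_top.ne
  have hb : 0 < ν * σ := mul_pos hν hσ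
  have hK : Integrable (heatKernel (E := E) (ν * σ)) volume := integrable_heatKernel_holds hb
  obtain ⟨C, hC⟩ := hφ.contDiff.continuous.bounded_above_of_compact_support hφ.hasCompactSupport
  have hφ2 : MemLp φ 2 volume :=
    hφ.contDiff.continuous.memLp_of_hasCompactSupport hφ.hasCompactSupport
  -- slices of the force
  have hfr : ∀ᵐ r ∂(volume.restrict (Ioo s τ)), Integrable (f r) volume := hf.prod_right_ae
  -- a pointwise bound of the translated pairing on the good slices
  have hbound : ∀ r, Integrable (f r) volume → ∀ (y : E) (a : ℝ),
      ‖∫ x, ⟪f r x, heatTest ν φ a (x - y)⟫‖ ≤ C * ∫ x, ‖f r x‖ := by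
    intro r hr y a
    calc ‖∫ x, ⟪f r x, heatTest ν φ a (x - y)⟫‖
        ≤ ∫ x, ‖⟪f r x, heatTest ν φ a (x - y)⟫‖ := norm_integral_le_integral_norm _
      _ ≤ ∫ x, C * ‖f r x‖ := by
          refine integral_mono_of_nonneg (Eventually.of_forall fun x => norm_nonneg _)
            (hr.norm.const_mul C) (Eventually.of_forall fun x => ?_)
          calc ‖⟪f r x, heatTest ν φ a (x - y)⟫‖ ≤ ‖f r x‖ * ‖heatTest ν φ a (x - y)‖ :=
                norm_inner_le_norm _ _
            _ ≤ ‖f r x‖ * C :=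
                mul_le_mul_of_nonneg_left (norm_heatTest_le_of_bound hC _ _) (norm_nonneg _)
            _ = C * ‖f r x‖ := mul_comm _ _
      _ = C * ∫ x, ‖f r x‖ := integral_const_mul _ _
  -- integrability on `E_y × (s,τ)_r`
  have hH := aestronglyMeasurable_force_translate hν hφ hf.1 (τ := τ)
  have hJm : AEStronglyMeasurable (fun z : E × ℝ => heatKernel (ν * σ) z.1 *
      ∫ x, ⟪f z.2 x, heatTest ν φ (τ - z.2) (x - z.1)⟫)
      ((volume : Measure E).prod (volume.restrict (Ioo s τ))) :=
    ((continuous_heatKernel _).aestronglyMeasurable.comp_fst).mul hH.integral_prod_right'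
  have hdom : Integrable (fun z : E × ℝ => ‖heatKernel (ν * σ) z.1‖ * (C * ∫ x, ‖f z.2 x‖))
      ((volume : Measure E).prod (volume.restrict (Ioo s τ))) :=
    hK.norm.mul_prod ((hf.integral_norm_prod_left).const_mul C)
  have hJ : Integrable (fun z : E × ℝ => heatKernel (ν * σ) z.1 *
      ∫ x, ⟪f z.2 x, heatTest ν φ (τ - z.2) (x - z.1)⟫)
      ((volume : Measure E).prod (volume.restrict (Ioo s τ))) := by
    refine hdom.mono' hJm ?_
    filter_upwards [(Measure.quasiMeasurePreserving_snd).ae hfr] with z hz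
    rw [norm_mul]
    exact mul_le_mul_of_nonneg_left (hbound z.2 hz z.1 _) (norm_nonneg _)
  -- `K(y) ∫_r F = ∫_r K(y) F`
  have hrw : ∀ y : E, heatKernel (ν * σ) y *
      ∫ r in Ioo s τ, ∫ x, ⟪f r x, heatTest ν φ (τ - r) (x - y)⟫ =
      ∫ r in Ioo s τ, heatKernel (ν * σ) y * ∫ x, ⟪f r x, heatTest ν φ (τ - r) (x - y)⟫ :=
    fun y => (integral_const_mul _ _).symm
  refine ⟨(hJ.integral_prod_left).congr (Eventually.of_forall fun y => (hrw y).symm), ?_⟩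
  simp_rw [hrw]
  rw [integral_integral_swap hJ]
  refine integral_congr_ae ?_
  filter_upwards [hfr, ae_restrict_mem measurableSet_Ioo] with r hr hrI
  have hτr : 0 ≤ τ - r := sub_nonneg.2 hrI.2.le
  have hw : MemLp (f r) 1 volume := memLp_one_iff_integrable.2 hr
  have hg : Continuous (heatTest ν φ (τ - r)) :=
    (contDiff_heatTest_of_hasCompactSupport hφ.contDiff hφ.hasCompactSupport _).continuous
  have hgC : ∀ x, ‖heatTest ν φ (τ - r) x‖ ≤ C := norm_heatTest_le_of_bound hC _
  have hg' : MemLp (heatTest ν φ (τ - r)) ∞ volume :=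
    memLp_top_of_bound hg.aestronglyMeasurable C (Eventually.of_forall hgC)
  rw [integral_heatKernel_mul_integral_inner_translate (q := 1) (q' := ∞) hw hg hg' hgC hb,
    heatExtension_heatTest_eq_heatTest_add hν hφ2 hτr hσ]

end Force

/-! ### Time integrability of the nonlinear and force pairings on `(s, t)` -/

section TimePairings

variable {ν : ℝ} {φ : E → E} {u f : ℝ → E → E} {s t : ℝ} {q p : ℝ≥0∞}

/-- The product measure `(dr on (s,t)) ⊗ dx` gives full measure to `{r ∈ (s, t)}`. [folklore] -/
private theorem ae_fst_mem_Ioo (s t : ℝ) :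
    ∀ᵐ z : ℝ × E ∂((volume.restrict (Ioo s t)).prod (volume : Measure E)), z.1 ∈ Ioo s t :=
  (Measure.quasiMeasurePreserving_fst).ae (ae_restrict_mem measurableSet_Ioo)

/-- **Joint measurability of the transport integrand** `(r, x) ↦ ⟪u(r,x), D(e^{ν(t-r)Δ}φ)(x) u(r,x)⟫`
on `(s,t) × E`. [folklore] -/
private theorem aestronglyMeasurable_transport (hν : 0 < ν) (hφ : ContDiff ℝ 1 φ) (hc : HasCompactSupport φ)
    (hmeas : AEStronglyMeasurable (uncurry u) ((volume.restrict (Ioo s t)).prod (volume : Measure E))) :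
    AEStronglyMeasurable (fun z : ℝ × E => ⟪u z.1 z.2, fderiv ℝ (heatTest ν φ (t - z.1)) z.2 (u z.1 z.2)⟫)
      ((volume.restrict (Ioo s t)).prod (volume : Measure E)) := by
  set μ := (volume.restrict (Ioo s t)).prod (volume : Measure E) with hμ
  have hU : AEStronglyMeasurable (fun z : ℝ × E => u z.1 z.2) μ := hmeas
  set S : Set (ℝ × E) := {z | z.1 ∈ Ioo s t} with hS
  have hSm : MeasurableSet S := measurableSet_Ioo.preimage measurable_fst
  have hΨc : ContinuousOn (fun z : ℝ × E => fderiv ℝ (heatTest ν φ (t - z.1)) z.2) S := by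
    have hc2 : Continuous fun z : ℝ × E => ((t - z.1, z.2) : ℝ × E) := by fun_prop
    have h := (continuousOn_fderiv_heatTest hν hφ hc).comp hc2.continuousOn
      (fun z (hz : z ∈ S) => ⟨show (0 : ℝ) < t - z.1 from sub_pos.2 hz.2, mem_univ _⟩)
    simpa only [Function.comp_def] using h
  have hae : ∀ᵐ z ∂μ, z ∈ S := ae_fst_mem_Ioo (E := E) s t
  have hΨ : AEStronglyMeasurable (fun z : ℝ × E => fderiv ℝ (heatTest ν φ (t - z.1)) z.2) μ := by
    have h := hΨc.aestronglyMeasurable (μ := μ) hSm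
    rwa [Measure.restrict_eq_self_of_ae_mem hae] at h
  exact hU.inner ((isBoundedBilinearMap_apply (𝕜 := ℝ) (E := E) (F := E)).continuous
    |>.comp_aestronglyMeasurable (hΨ.prodMk hU))

/-- **Interval integrability of the transport pairing** `r ↦ ∫ ⟪u(r), (u(r)·∇) e^{ν(t-r)Δ}φ⟫` on
`[s, t]` for `u ∈ L^∞((s,t); L^q)` jointly measurable, `q ≥ 2` (bound `M² ‖Dφ‖_p` for a.e. `r`).
[folklore] -/
private theorem intervalIntegrable_transport (hν : 0 < ν) (hφ : ContDiff ℝ 1 φ) (hc : HasCompactSupport φ)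
    [hp : (q / 2).HolderConjugate p] (hp1 : 1 ≤ p) (hst : s ≤ t)
    (hmeas : AEStronglyMeasurable (uncurry u) ((volume.restrict (Ioo s t)).prod (volume : Measure E)))
    {M : ℝ≥0∞} (hMt : M ≠ ⊤)
    (hae : ∀ᵐ r ∂(volume.restrict (Ioo s t)), MemLp (u r) q volume ∧ eLpNorm (u r) q volume ≤ M) :
    IntervalIntegrable (fun r => ∫ x, ⟪u r x, convect (u r) (heatTest ν φ (t - r)) x⟫) volume s t := by
  rw [intervalIntegrable_iff_integrableOn_Ioc_of_le hst, integrableOn_Ioc_iff_integrableOn_Ioo]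
  haveI : IsFiniteMeasure (volume.restrict (Ioo s t) : Measure ℝ) :=
    isFiniteMeasure_restrict.2 measure_Ioo_lt_top.ne
  set B : ℝ := (M * M * eLpNorm (fderiv ℝ φ) p volume).toReal with hB
  refine Integrable.mono' (integrable_const B)
    ((aestronglyMeasurable_transport hν hφ hc hmeas).integral_prod_right') ?_
  filter_upwards [hae, ae_restrict_mem measurableSet_Ioo] with r hr hrI
  have h := abs_integral_transport_translate_le hν hφ hc hp1 hMt hr.1 hr.2
    (sub_nonneg.2 hrI.2.le) (0 : E)
  simpa only [sub_zero, convect, Real.norm_eq_abs] using h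

/-- **Joint measurability of the force pairing integrand** `(r, x) ↦ ⟪f(r,x), (e^{ν(t-r)Δ}φ)(x)⟫`
on `(s,t) × E`. [folklore] -/
private theorem aestronglyMeasurable_force (hν : 0 < ν) (hφ : FunctionSpaces.IsTestFunctionOn (⊤ : Opens E) φ)
    (hf : AEStronglyMeasurable (uncurry f) ((volume.restrict (Ioo s t)).prod (volume : Measure E))) :
    AEStronglyMeasurable (fun z : ℝ × E => ⟪f z.1 z.2, heatTest ν φ (t - z.1) z.2⟫)
      ((volume.restrict (Ioo s t)).prod (volume : Measure E)) := by
  set μ := (volume.restrict (Ioo s t)).prod (volume : Measure E) with hμ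
  have hF : AEStronglyMeasurable (fun z : ℝ × E => f z.1 z.2) μ := hf
  obtain ⟨C, hC⟩ := hφ.contDiff.continuous.bounded_above_of_compact_support hφ.hasCompactSupport
  set S : Set (ℝ × E) := {z | z.1 ∈ Ioo s t} with hS
  have hSm : MeasurableSet S := measurableSet_Ioo.preimage measurable_fst
  have hψc : ContinuousOn (fun z : ℝ × E => heatTest ν φ (t - z.1) z.2) S := by
    have hc2 : Continuous fun z : ℝ × E => ((ν * (t - z.1), z.2) : ℝ × E) := by fun_prop
    have h := (UnboundedOperators.continuousOn_uncurry_heatExtension hφ.contDiff.continuous hC).comp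
      hc2.continuousOn
      (fun z (hz : z ∈ S) => ⟨show (0 : ℝ) < ν * (t - z.1) from mul_pos hν (sub_pos.2 hz.2),
        mem_univ _⟩)
    refine ContinuousOn.congr (by simpa only [Function.comp_def] using h) fun z hz => ?_
    exact congrFun (heatTest_of_pos hν (sub_pos.2 hz.2) φ) _
  have hae : ∀ᵐ z ∂μ, z ∈ S := ae_fst_mem_Ioo (E := E) s t
  have hψ : AEStronglyMeasurable (fun z : ℝ × E => heatTest ν φ (t - z.1) z.2) μ := by
    have h := hψc.aestronglyMeasurable (μ := μ) hSm
    rwa [Measure.restrict_eq_self_of_ae_mem hae] at h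
  exact hF.inner hψ

/-- **Interval integrability of the force pairing** `r ↦ ∫ ⟪f(r), e^{ν(t-r)Δ}φ⟫` on `[s, t]` for
`f ∈ L¹((s,t) × E)` (bound `‖φ‖_∞ ∫ |f(r)|`). [folklore] -/
private theorem intervalIntegrable_force (hν : 0 < ν) (hφ : FunctionSpaces.IsTestFunctionOn (⊤ : Opens E) φ)
    (hst : s ≤ t) (hf : Integrable (uncurry f) ((volume.restrict (Ioo s t)).prod (volume : Measure E))) :
    IntervalIntegrable (fun r => ∫ x, ⟪f r x, heatTest ν φ (t - r) x⟫) volume s t := by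
  rw [intervalIntegrable_iff_integrableOn_Ioc_of_le hst, integrableOn_Ioc_iff_integrableOn_Ioo]
  obtain ⟨C, hC⟩ := hφ.contDiff.continuous.bounded_above_of_compact_support hφ.hasCompactSupport
  refine Integrable.mono' ((hf.integral_norm_prod_left).const_mul C)
    ((aestronglyMeasurable_force hν hφ hf.1).integral_prod_right') ?_
  filter_upwards [hf.prod_right_ae] with r hr
  calc ‖∫ x, ⟪f r x, heatTest ν φ (t - r) x⟫‖
      ≤ ∫ x, ‖⟪f r x, heatTest ν φ (t - r) x⟫‖ := norm_integral_le_integral_norm _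
    _ ≤ ∫ x, C * ‖f r x‖ := by
        refine integral_mono_of_nonneg (Eventually.of_forall fun x => norm_nonneg _)
          (hr.norm.const_mul C) (Eventually.of_forall fun x => ?_)
        calc ‖⟪f r x, heatTest ν φ (t - r) x⟫‖ ≤ ‖f r x‖ * ‖heatTest ν φ (t - r) x‖ :=
              norm_inner_le_norm _ _
          _ ≤ ‖f r x‖ * C :=
              mul_le_mul_of_nonneg_left (norm_heatTest_le_of_bound hC _ _) (norm_nonneg _)
          _ = C * ‖f r x‖ := mul_comm _ _
    _ = C * ∫ x, ‖f r x‖ := integral_const_mul _ _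

end TimePairings

/-! ### Step A: the identity between `s` and `τ` tested with the caloric field `e^{νσΔ}φ` -/

section StepA

variable {ν : ℝ} {f u : ℝ → E → E} {s τ : ℝ} {q : ℝ≥0∞} {φ : E → E}

/-- **The two-time identity extends to caloric test fields.** If the identity holds between `s`
and `τ` (class hypotheses as in `IsMildNSSolutionBetween.trans`, on the slab `(s,τ) × E`), then for
every smooth compactly supported divergence-free `φ` and `σ > 0` it holds with the test
`ψ = e^{νσΔ}φ` in place of `φ`:
`⟨u(τ), e^{νσΔ}φ⟩ = ⟨u(s), e^{ν(τ-s+σ)Δ}φ⟩ + ∫ₛ^τ ⟨u ⊗ u, ∇e^{ν(τ-r+σ)Δ}φ⟩ + ∫ₛ^τ ⟨f, e^{ν(τ-r+σ)Δ}φ⟩`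
(superposition of the identities for the translates `φ(· - y)` against `heatKernel (νσ) y dy`;
Fabes–Jones–Rivière 1972, proof of Thm. 2.1). [cite: FabesJonesRiviere1972, proof of Thm. 2.1] -/
theorem IsMildNSSolutionBetween.integral_inner_heatTest_eq (h₁ : IsMildNSSolutionBetween ν f u s τ)
    (hν : 0 < ν) (hsτ : s ≤ τ)
    (hmeas : AEStronglyMeasurable (uncurry u) (volume.restrict (Ioo s τ ×ˢ univ)))
    (hq : 2 ≤ q) (hu : MemLqLp ∞ q u (Ioo s τ)) (hus : MemLp (u s) q volume)
    (huτ : MemLp (u τ) q volume) (hf : IntegrableOn (uncurry f) (Ioo s τ ×ˢ univ) volume)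
    (hφ : FunctionSpaces.IsTestFunctionOn (⊤ : Opens E) φ) (hdiv : VectorCalculus.IsDivFree φ)
    {σ : ℝ} (hσ : 0 < σ) :
    ∫ x, ⟪u τ x, heatTest ν φ σ x⟫ =
      (∫ x, ⟪u s x, heatTest ν φ (τ - s + σ) x⟫) +
      (∫ r in s..τ, ∫ x, ⟪u r x, convect (u r) (heatTest ν φ (τ - r + σ)) x⟫) +
      ∫ r in s..τ, ∫ x, ⟪f r x, heatTest ν φ (τ - r + σ) x⟫ := by
  rcases hsτ.eq_or_lt with rfl | hsτ'
  · -- at `s = τ` both time integrals vanish and the datum term is the left-hand side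
    simp only [intervalIntegral.integral_same, add_zero, sub_self, zero_add]
  -- exponents
  have hq1 : 1 ≤ q := le_trans (by norm_num) hq
  haveI hqc : q.HolderConjugate (ENNReal.conjExponent q) := .conjExponent hq1
  have hq2 : 1 ≤ q / 2 := by
    rw [ENNReal.le_div_iff_mul_le (Or.inl (by norm_num)) (Or.inl (by norm_num)), one_mul]
    exact hq
  set p : ℝ≥0∞ := ENNReal.conjExponent (q / 2) with hp_def
  haveI hpc : (q / 2).HolderConjugate p := .conjExponent hq2
  have hp1 : 1 ≤ p := ENNReal.HolderConjugate.one_le p (q / 2)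
  have hq'1 : 1 ≤ ENNReal.conjExponent q := ENNReal.HolderConjugate.one_le (ENNReal.conjExponent q) q
  -- the test field
  have hφ1 : ContDiff ℝ 1 φ := hφ.contDiff.of_le (by exact_mod_cast le_top)
  have hφc : HasCompactSupport φ := hφ.hasCompactSupport
  have hφcont : Continuous φ := hφ.contDiff.continuous
  have hφp : ∀ r : ℝ≥0∞, MemLp φ r volume := fun r => hφcont.memLp_of_hasCompactSupport hφc
  obtain ⟨Cφ, hCφ⟩ := hφcont.bounded_above_of_compact_support hφc
  have hb : 0 < ν * σ := mul_pos hν hσ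
  -- the class hypotheses in product form
  have hmeas' : AEStronglyMeasurable (uncurry u) ((volume.restrict (Ioo s τ)).prod (volume : Measure E)) := by
    rwa [← volume_restrict_slab_eq_prod]
  have hf' : Integrable (uncurry f) ((volume.restrict (Ioo s τ)).prod (volume : Measure E)) := by
    have h : Integrable (uncurry f) (volume.restrict (Ioo s τ ×ˢ univ)) := hf
    rwa [volume_restrict_slab_eq_prod] at h
  set M : ℝ≥0∞ := eLqLpNorm ∞ q u (Ioo s τ) with hM_def
  have hMt : M ≠ ⊤ := hu.2.ne
  have hae : ∀ᵐ r ∂(volume.restrict (Ioo s τ)), MemLp (u r) q volume ∧ eLpNorm (u r) q volume ≤ M :=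
    hu.1.and hu.ae_eLpNorm_le_top
  -- ### the identity for the translates `φ(· - y)`
  have hId : ∀ y : E, ∫ x, ⟪u τ x, φ (x - y)⟫ =
      (∫ x, ⟪u s x, heatTest ν φ (τ - s) (x - y)⟫) +
      (∫ r in Ioo s τ, ∫ x, ⟪u r x, fderiv ℝ (heatTest ν φ (τ - r)) (x - y) (u r x)⟫) +
      ∫ r in Ioo s τ, ∫ x, ⟪f r x, heatTest ν φ (τ - r) (x - y)⟫ := by
    intro y
    have key := h₁ (fun x => φ (x - y)) (isTestFunctionOn_comp_sub_right_top hφ y)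
      (isDivFree_comp_sub_right hdiv y)
    have eF : ∀ a : ℝ, heatTest ν (fun x => φ (x - y)) a = fun x => heatTest ν φ a (x - y) :=
      fun a => funext fun x => heatTest_comp_sub_right ν φ y a x
    have eD : ∀ (a : ℝ) (x : E), fderiv ℝ (fun x => heatTest ν φ a (x - y)) x =
        fderiv ℝ (heatTest ν φ a) (x - y) := fun a x => fderiv_comp_sub y
    simp only [convect, eF, eD, intervalIntegral.integral_of_le hsτ'.le,
      integral_Ioc_eq_integral_Ioo] at key
    exact key
  -- ### the four superpositions
  have hL : ∫ y, heatKernel (ν * σ) y * ∫ x, ⟪u τ x, φ (x - y)⟫ = ∫ x, ⟪u τ x, heatTest ν φ σ x⟫ := by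
    rw [integral_heatKernel_mul_integral_inner_translate huτ hφcont (hφp (ENNReal.conjExponent q))
      hCφ hb, heatTest_of_pos hν hσ]
  have hg : Continuous (heatTest ν φ (τ - s)) := (contDiff_heatTest_of_hasCompactSupport hφ.contDiff hφc _).continuous
  have hgq : MemLp (heatTest ν φ (τ - s)) (ENNReal.conjExponent q) volume :=
    memLp_heatTest_of_memLp hν.le (hφp _) hq'1 (sub_nonneg.2 hsτ'.le)
  have hgC : ∀ x, ‖heatTest ν φ (τ - s) x‖ ≤ Cφ := norm_heatTest_le_of_bound hCφ _
  have hD : ∫ y, heatKernel (ν * σ) y * ∫ x, ⟪u s x, heatTest ν φ (τ - s) (x - y)⟫ =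
      ∫ x, ⟪u s x, heatTest ν φ (τ - s + σ) x⟫ := by
    rw [integral_heatKernel_mul_integral_inner_translate hus hg hgq hgC hb,
      heatExtension_heatTest_eq_heatTest_add hν (hφp 2) (sub_nonneg.2 hsτ'.le) hσ]
  have hDi : Integrable (fun y => heatKernel (ν * σ) y *
      ∫ x, ⟪u s x, heatTest ν φ (τ - s) (x - y)⟫) volume :=
    ((integrable_heatKernel_mul_inner_translate hus hg hgq hb).integral_prod_left).congr
      (Eventually.of_forall fun y => by dsimp only; exact integral_const_mul _ _)
  obtain ⟨hNi, hN⟩ := integral_heatKernel_mul_setIntegral_transport hν hφ1 hφc hp1 hmeas' hMt hae hσ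
    (τ := τ)
  obtain ⟨hFi, hF⟩ := integral_heatKernel_mul_setIntegral_force hν hφ hf' hσ (τ := τ)
  -- ### assemble
  rw [intervalIntegral.integral_of_le hsτ'.le, intervalIntegral.integral_of_le hsτ'.le,
    integral_Ioc_eq_integral_Ioo, integral_Ioc_eq_integral_Ioo, ← hL]
  simp only [convect]
  calc ∫ y, heatKernel (ν * σ) y * ∫ x, ⟪u τ x, φ (x - y)⟫
      = ∫ y, (heatKernel (ν * σ) y * ∫ x, ⟪u s x, heatTest ν φ (τ - s) (x - y)⟫) +
          (heatKernel (ν * σ) y *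
            ∫ r in Ioo s τ, ∫ x, ⟪u r x, fderiv ℝ (heatTest ν φ (τ - r)) (x - y) (u r x)⟫) +
          heatKernel (ν * σ) y * ∫ r in Ioo s τ, ∫ x, ⟪f r x, heatTest ν φ (τ - r) (x - y)⟫ := by
        refine integral_congr_ae (Eventually.of_forall fun y => ?_)
        dsimp only
        rw [hId y, mul_add, mul_add]
    _ = (∫ y, (heatKernel (ν * σ) y * ∫ x, ⟪u s x, heatTest ν φ (τ - s) (x - y)⟫) +
          heatKernel (ν * σ) y *
            ∫ r in Ioo s τ, ∫ x, ⟪u r x, fderiv ℝ (heatTest ν φ (τ - r)) (x - y) (u r x)⟫) +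
        ∫ y, heatKernel (ν * σ) y * ∫ r in Ioo s τ, ∫ x, ⟪f r x, heatTest ν φ (τ - r) (x - y)⟫ :=
        integral_add (hDi.add hNi) hFi
    _ = (∫ y, heatKernel (ν * σ) y * ∫ x, ⟪u s x, heatTest ν φ (τ - s) (x - y)⟫) +
        (∫ y, heatKernel (ν * σ) y *
            ∫ r in Ioo s τ, ∫ x, ⟪u r x, fderiv ℝ (heatTest ν φ (τ - r)) (x - y) (u r x)⟫) +
        ∫ y, heatKernel (ν * σ) y * ∫ r in Ioo s τ, ∫ x, ⟪f r x, heatTest ν φ (τ - r) (x - y)⟫ := by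
        rw [integral_add hDi hNi]
    _ = _ := by rw [hD, hN, hF]

end StepA

/-! ### The discharge -/

section Discharge

/-- **Transitivity of the two-time duality identity** — the DISCHARGE of the named fact
`Literature.Analysis.FluidPDE.IsMildNSSolutionBetween.trans` (Fabes–Jones–Rivière 1972, proof of
Thm. 2.1; Lemarié-Rieusset 2016, Thm. 6.1 / Prop. 6.5): if the forced two-time identity holds
between `s` and `τ` and between `τ` and `t`, `s ≤ τ ≤ t`, for `u ∈ L^∞((s,t); L^q)`, `q ≥ 2`,
jointly measurable on `(s,t) × E`, with `u s, u τ ∈ L^q`, `f ∈ L¹((s,t) × E)`, `0 < ν`, then it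
holds between `s` and `t` (test the second identity with `φ`, the first with `e^{ν(t-τ)Δ}φ` —
`IsMildNSSolutionBetween.integral_inner_heatTest_eq` — and add, using the semigroup law and
`∫ₛ^τ + ∫_τ^t = ∫ₛᵗ`). [cite: FabesJonesRiviere1972, proof of Thm. 2.1] [cite: LemarieRieusset2016, Thm. 6.1 and Prop. 6.5] -/
theorem IsMildNSSolutionBetween.trans_holds {ν : ℝ} {f u : ℝ → E → E} :
    IsMildNSSolutionBetween.trans (E := E) (ν := ν) (f := f) (u := u) := by
  intro s τ t h₁ h₂ hν hsτ hτt hmeas q hq hu hus huτ hf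
  rcases hτt.eq_or_lt with rfl | hτt'
  · exact h₁
  intro φ hφ hdiv
  have hσ : 0 < t - τ := sub_pos.2 hτt'
  have hst : s ≤ t := hsτ.trans hτt
  -- exponents (for the time integrability of the nonlinear pairing)
  have hq2 : 1 ≤ q / 2 := by
    rw [ENNReal.le_div_iff_mul_le (Or.inl (by norm_num)) (Or.inl (by norm_num)), one_mul]
    exact hq
  set p : ℝ≥0∞ := ENNReal.conjExponent (q / 2) with hp_def
  haveI hpc : (q / 2).HolderConjugate p := .conjExponent hq2
  have hp1 : 1 ≤ p := ENNReal.HolderConjugate.one_le p (q / 2)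
  have hφ1 : ContDiff ℝ 1 φ := hφ.contDiff.of_le (by exact_mod_cast le_top)
  have hφc : HasCompactSupport φ := hφ.hasCompactSupport
  -- the class hypotheses in product form, on `(s,t)` and on the sub-slab `(s,τ)`
  have hmeas' : AEStronglyMeasurable (uncurry u) ((volume.restrict (Ioo s t)).prod (volume : Measure E)) := by
    rwa [← volume_restrict_slab_eq_prod]
  have hf' : Integrable (uncurry f) ((volume.restrict (Ioo s t)).prod (volume : Measure E)) := by
    have h : Integrable (uncurry f) (volume.restrict (Ioo s t ×ˢ univ)) := hf
    rwa [volume_restrict_slab_eq_prod] at h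
  set M : ℝ≥0∞ := eLqLpNorm ∞ q u (Ioo s t) with hM_def
  have hMt : M ≠ ⊤ := hu.2.ne
  have hae : ∀ᵐ r ∂(volume.restrict (Ioo s t)), MemLp (u r) q volume ∧ eLpNorm (u r) q volume ≤ M :=
    hu.1.and hu.ae_eLpNorm_le_top
  have hsub : Ioo s τ ×ˢ (univ : Set E) ⊆ Ioo s t ×ˢ univ :=
    prod_mono (Ioo_subset_Ioo le_rfl hτt) subset_rfl
  have hmeas_τ : AEStronglyMeasurable (uncurry u) (volume.restrict (Ioo s τ ×ˢ univ)) :=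
    hmeas.mono_measure (Measure.restrict_mono hsub le_rfl)
  have hu_τ : MemLqLp ∞ q u (Ioo s τ) := hu.mono_set (Ioo_subset_Ioo le_rfl hτt)
  have hf_τ : IntegrableOn (uncurry f) (Ioo s τ ×ˢ univ) volume := hf.mono_set hsub
  -- the time pairings with the test `φ` at final time `t`
  set N : ℝ → ℝ := fun r => ∫ x, ⟪u r x, convect (u r) (heatTest ν φ (t - r)) x⟫ with hN
  set F : ℝ → ℝ := fun r => ∫ x, ⟪f r x, heatTest ν φ (t - r) x⟫ with hF
  have hN_int : IntervalIntegrable N volume s t :=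
    intervalIntegrable_transport hν hφ1 hφc hp1 hst hmeas' hMt hae
  have hF_int : IntervalIntegrable F volume s t := intervalIntegrable_force hν hφ hst hf'
  have hIcc : uIcc s τ ⊆ uIcc s t := by
    rw [uIcc_of_le hsτ, uIcc_of_le hst]; exact Icc_subset_Icc_right hτt
  have hIcc' : uIcc τ t ⊆ uIcc s t := by
    rw [uIcc_of_le hτt, uIcc_of_le hst]; exact Icc_subset_Icc_left hsτ
  have hsplitN : ∫ r in s..t, N r = (∫ r in s..τ, N r) + ∫ r in τ..t, N r :=
    (intervalIntegral.integral_add_adjacent_intervals (hN_int.mono_set hIcc)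
      (hN_int.mono_set hIcc')).symm
  have hsplitF : ∫ r in s..t, F r = (∫ r in s..τ, F r) + ∫ r in τ..t, F r :=
    (intervalIntegral.integral_add_adjacent_intervals (hF_int.mono_set hIcc)
      (hF_int.mono_set hIcc')).symm
  -- Step B: the identity between `τ` and `t`, tested with `φ`
  have hB := h₂ φ hφ hdiv
  -- Step A: the identity between `s` and `τ`, tested with `e^{ν(t-τ)Δ}φ`
  have hA := h₁.integral_inner_heatTest_eq hν hsτ hmeas_τ hq hu_τ hus huτ hf_τ hφ hdiv hσ
  have e1 : τ - s + (t - τ) = t - s := by ring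
  have e2 : ∀ r : ℝ, τ - r + (t - τ) = t - r := fun r => by ring
  simp only [e1, e2] at hA
  change ∫ x, ⟪u t x, φ x⟫ = (∫ x, ⟪u s x, heatTest ν φ (t - s) x⟫) + (∫ r in s..t, N r) +
    ∫ r in s..t, F r
  change ∫ x, ⟪u t x, φ x⟫ = (∫ x, ⟪u τ x, heatTest ν φ (t - τ) x⟫) + (∫ r in τ..t, N r) +
    ∫ r in τ..t, F r at hB
  change ∫ x, ⟪u τ x, heatTest ν φ (t - τ) x⟫ = (∫ x, ⟪u s x, heatTest ν φ (t - s) x⟫) +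
    (∫ r in s..τ, N r) + ∫ r in s..τ, F r at hA
  rw [hB, hA, hsplitN, hsplitF]
  ring

end Discharge

end Literature.Analysis.FluidPDE

end
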